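import Literature.NumberTheory.PAdicHodge.EisensteinRootWittDatum
import HarnessLib

/-!
# The ramified Fontaine ring `A_inf(𝒪_F) = 𝒪_F ⊗_{W(k_F)} 𝔸_inf(F) = 𝔸_inf(F)[X]/(E)` for a GENERAL `p`-adic
# field: ring, `Γ_F`-action, `θ_𝒪`

Topic `Literature/NumberTheory/PAdicHodge`; sequel of `EisensteinRootWittDatum` (`D = (E, π)`, `E ∈ W(k_F)[X]`
Eisenstein), `UnramifiedWittFixedPoints` (`W(k_F) → 𝔸_inf(F)`, `Γ_F`-invariant, `θ`-compatible), `FontaineThetaGalois`.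

`AinfRamified` constructs `A_inf(𝒪) = 𝔸_inf(F)[X]/(f)` only for an Eisenstein `f ∈ ℤ_p[X]`, i.e. for the ring of
integers `ℤ_p[ϖ]` of a TOTALLY RAMIFIED `p`-adic field (its header records the general case as a TODO).  For a
`p`-adic field `F` of residue degree `f ≥ 1` the coefficient ring of the Lubin–Tate formal group is
`𝒪_F = W(k_F)[π]`, `π` a root of an Eisenstein polynomial `E ∈ W(k_F)[X]`, and the natural period ring is
Fargues–Fontaine's `𝒪_F ⊗_{W(k_F)} W(𝒪_{ℂ_F}♭) = 𝔸_inf(F)[X]/(E)` (Astérisque 406 §1.2, `W_{𝒪_E}(A) = 𝒪_E ⊗_{W(𝔽_q)}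
W(A)`), with `W(k_F) ↪ 𝔸_inf(F)` the `Γ_F`-fixed Witt vectors (tree `wittFixedToAinf`).  For `D : EisensteinRootW F p hp`:

* §2 `AinfRamW D = AdjoinRoot (E ⊗ 𝔸_inf(F))`, power basis `1, ϖ, …, ϖ^{e-1}` over `𝔸_inf(F)` (`powerBasis`),
  `ringHom_ext`, the coefficient map `𝒪_D = W(k_F)[X]/(E) → A_inf(𝒪_F)` (`coeffHom`).
* §3 **the action of `Γ_F`** (`AinfRamW.gal`: `𝕎(σ♭)` on `𝔸_inf(F)` — which fixes `W(k_F)` — and `ϖ ↦ ϖ`),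
  `gal_one`, `gal_mul`, fixing `𝒪_D` (no instance is declared; the action is the explicit `gal`).
* §4 **`θ_𝒪 : A_inf(𝒪_F) → 𝒪_{ℂ_F}`** (`AinfRamW.theta`: Fontaine's `θ` on `𝔸_inf(F)`, `ϖ ↦ π`), surjective,
  compatible with `𝒪_D → F ⊆ ℂ_F`, `Γ_F`-equivariant.

NOTE: unlike the `ℤ_p`-case, `A_inf(𝒪_F)` carries NO Frobenius lift of `φ` (the coefficients of `E` are not
`φ`-fixed when `f ≥ 2`); the Frobenius-twisted specialisations `A_inf(𝒪_F) → 𝒪_{ℂ_F}` are a sequel.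
Definitions (reviewed): `EisensteinRootW.polyAinf`, `AinfRamW` (+ `.varpi`, `.powerBasis`, `.coeffHom`, `.gal`,
`.theta`).  No named facts, no instances, no `sorry`.

## References
* [FarguesFontaine2018] L. Fargues, J.-M. Fontaine, *Courbes et fibrés vectoriels en théorie de Hodge p-adique*,
  Astérisque 406 (2018), §1.2 (ramified Witt vectors `W_{𝒪_E} = 𝒪_E ⊗_{W(𝔽_q)} W`), §2.2 (`θ`).
* [FontaineAsterisque223III] J.-M. Fontaine, *Le corps des périodes p-adiques*, Astérisque 223 (1994), Exp. II §1.2.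
* [SerreLocalFields1979] J.-P. Serre, *Local Fields*, Ch. I §6, Ch. II §5 (`𝒪_F = W(k_F)[π]`).
-/

noncomputable section

open ValuativeRel Field Ideal WittVector Polynomial

namespace Literature.NumberTheory.PAdicHodge

open Literature.NumberTheory.GaloisRepresentations
open Literature.NumberTheory.GaloisRepresentations.IsNonarchimedeanLocalField

variable {F : Type} [Field F] [ValuativeRel F] [TopologicalSpace F] [IsNonarchimedeanLocalField F]
  [CharZero F] {p : ℕ} [Fact p.Prime]

/-! ## §2 The ring `A_inf(𝒪_F) = 𝔸_inf(F)[X]/(E)` -/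

section Ring

variable [Fact (¬ IsUnit (p : integerC F))] {hp : valuation F p < 1}

namespace EisensteinRootW

variable (D : EisensteinRootW F p hp)

/-- `E ⊗ 𝔸_inf(F)`: the Eisenstein polynomial with its coefficients pushed along `W(k_F) → 𝔸_inf(F)` (tree
`wittFixedToAinf`). [cite: FarguesFontaine2018, §1.2] -/
def polyAinf : (Ainf (p := p) F)[X] := D.poly.map (wittFixedToAinf F p hp)

/-- Unfolding `polyAinf`. [cite: FarguesFontaine2018, §1.2] -/
theorem polyAinf_def : D.polyAinf = D.poly.map (wittFixedToAinf F p hp) := rfl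

/-- Evaluating `E ⊗ 𝔸_inf` is evaluating `E` along the composite coefficient map. [cite: FarguesFontaine2018, §1.2] -/
theorem eval₂_polyAinf {S : Type*} [CommRing S] (g : Ainf (p := p) F →+* S) (x : S) :
    D.polyAinf.eval₂ g x = D.poly.eval₂ (g.comp (wittFixedToAinf F p hp)) x := by
  rw [polyAinf_def, Polynomial.eval₂_map]

/-- `E ⊗ 𝔸_inf` is monic (stated on the unfolded `polyAinf`; use as `(D.monic_polyAinf : D.polyAinf.Monic)`).
[cite: FarguesFontaine2018, §1.2] -/
theorem monic_polyAinf : (D.poly.map (wittFixedToAinf F p hp)).Monic := D.monic.map _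

/-- `deg (E ⊗ 𝔸_inf) = e`. [cite: FarguesFontaine2018, §1.2] -/
theorem natDegree_polyAinf : D.polyAinf.natDegree = D.deg := by
  rw [polyAinf_def, D.monic.natDegree_map, deg_def]

end EisensteinRootW

/-- **The ramified Fontaine ring `A_inf(𝒪_F) = 𝔸_inf(F)[X]/(E) = 𝒪_D ⊗_{W(k_F)} 𝔸_inf(F) = 𝔸_inf(F)[π]`** of the
Eisenstein root datum `D = (E, π)` over `W(k_F)` (Mathlib `AdjoinRoot` of `E ⊗ 𝔸_inf(F)`): Fargues–Fontaine's ramified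
Witt ring `W_{𝒪_F}(𝒪_{ℂ_F}♭) = 𝒪_F ⊗_{W(k_F)} W(𝒪_{ℂ_F}♭)`, for a general `p`-adic field `F`.
[cite: FarguesFontaine2018, §1.2] -/
abbrev AinfRamW (D : EisensteinRootW F p hp) : Type := AdjoinRoot D.polyAinf

namespace AinfRamW

variable (D : EisensteinRootW F p hp)

/-- **`ϖ ∈ A_inf(𝒪_F)`**: the class of `X`. [cite: FarguesFontaine2018, §1.2] -/
def varpi : AinfRamW D := AdjoinRoot.root D.polyAinf

/-- The structure map `𝔸_inf(F) → A_inf(𝒪_F)` is `AdjoinRoot.of`. [cite: FarguesFontaine2018, §1.2] -/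
theorem algebraMap_eq : algebraMap (Ainf (p := p) F) (AinfRamW D) = AdjoinRoot.of D.polyAinf := rfl

/-- `E(ϖ) = 0` in `A_inf(𝒪_F)`. [cite: FarguesFontaine2018, §1.2] -/
theorem eval₂_varpi : D.polyAinf.eval₂ (algebraMap (Ainf (p := p) F) (AinfRamW D)) (varpi D) = 0 :=
  AdjoinRoot.eval₂_root _

/-- `E(ϖ) = 0` in `A_inf(𝒪_F)`, coefficients from `W(k_F)`. [cite: FarguesFontaine2018, §1.2] -/
theorem eval₂_varpi' :
    D.poly.eval₂ ((algebraMap (Ainf (p := p) F) (AinfRamW D)).comp (wittFixedToAinf F p hp)) (varpi D) = 0 := by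
  rw [← EisensteinRootW.eval₂_polyAinf]; exact eval₂_varpi D

/-- The class of a polynomial is its value at `ϖ`. [cite: FarguesFontaine2018, §1.2] -/
theorem mk_eq_eval₂ (q : (Ainf (p := p) F)[X]) :
    AdjoinRoot.mk D.polyAinf q = q.eval₂ (algebraMap (Ainf (p := p) F) (AinfRamW D)) (varpi D) := by
  rw [← AdjoinRoot.aeval_eq, Polynomial.aeval_def]; rfl

/-- **Ring homomorphisms out of `A_inf(𝒪_F)` are determined on `𝔸_inf(F)` and on `ϖ`.** [cite: FarguesFontaine2018, §1.2] -/
theorem ringHom_ext {S : Type*} [Semiring S] {g h : AinfRamW D →+* S}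
    (h_of : ∀ a : Ainf (p := p) F,
      g (algebraMap (Ainf (p := p) F) (AinfRamW D) a) = h (algebraMap (Ainf (p := p) F) (AinfRamW D) a))
    (h_root : g (varpi D) = h (varpi D)) : g = h := by
  refine RingHom.ext fun x => ?_
  induction x using AdjoinRoot.induction_on with
  | ih q =>
    rw [mk_eq_eval₂, Polynomial.hom_eval₂, Polynomial.hom_eval₂, h_root]
    congr 1
    exact RingHom.ext h_of

/-- **The power basis `1, ϖ, …, ϖ^{e-1}` of `A_inf(𝒪_F)` over `𝔸_inf(F)`** (Mathlib `AdjoinRoot.powerBasis'` for the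
monic `E ⊗ 𝔸_inf`): a free `𝔸_inf(F)`-module of rank `e`. [cite: FarguesFontaine2018, §1.2] -/
def powerBasis : PowerBasis (Ainf (p := p) F) (AinfRamW D) := AdjoinRoot.powerBasis' D.monic_polyAinf

/-- The generator of the power basis is `ϖ`. [cite: FarguesFontaine2018, §1.2] -/
@[simp] theorem powerBasis_gen : (powerBasis D).gen = varpi D := AdjoinRoot.powerBasis'_gen D.monic_polyAinf

/-- The rank of `A_inf(𝒪_F)` over `𝔸_inf(F)` is `e`. [cite: FarguesFontaine2018, §1.2] -/
@[simp] theorem powerBasis_dim : (powerBasis D).dim = D.deg := by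
  rw [powerBasis, AdjoinRoot.powerBasis'_dim, D.natDegree_polyAinf]

/-- The basis vectors are the powers `ϖ^i`. [cite: FarguesFontaine2018, §1.2] -/
theorem powerBasis_basis_apply (i : Fin (powerBasis D).dim) : (powerBasis D).basis i = varpi D ^ (i : ℕ) := by
  rw [PowerBasis.coe_basis, powerBasis_gen]

/-- **`𝒪_D → A_inf(𝒪_F)`, `X ↦ ϖ`** (`W(k_F) → 𝔸_inf(F)` on coefficients). [cite: FarguesFontaine2018, §1.2] -/
def coeffHom : D.Coeff →+* AinfRamW D :=
  AdjoinRoot.lift ((algebraMap (Ainf (p := p) F) (AinfRamW D)).comp (wittFixedToAinf F p hp)) (varpi D) (eval₂_varpi' D)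

/-- `𝒪_D → A_inf(𝒪_F)` on `W(k_F)`. [cite: FarguesFontaine2018, §1.2] -/
@[simp] theorem coeffHom_of (z : wittFixed F p) :
    coeffHom D (AdjoinRoot.of D.poly z) = algebraMap (Ainf (p := p) F) (AinfRamW D) (wittFixedToAinf F p hp z) :=
  AdjoinRoot.lift_of _

/-- `𝒪_D → A_inf(𝒪_F)` on `X`. [cite: FarguesFontaine2018, §1.2] -/
@[simp] theorem coeffHom_root : coeffHom D (AdjoinRoot.root D.poly) = varpi D := AdjoinRoot.lift_root _

/-! ## §3 The action of `Γ_F` -/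

/-- **The action of `σ ∈ Γ_F` on `A_inf(𝒪_F)`**: `𝕎(σ♭)` on `𝔸_inf(F)` and `σ(ϖ) = ϖ` (`π ∈ F` is fixed by `Γ_F`; well
defined since `σ` fixes the coefficients `W(k_F)` of `E`, tree `galAinf_comp_wittFixedToAinf`).
[cite: FarguesFontaine2018, §1.2] [cite: FontaineAsterisque223III, Exp. II §1.2] -/
def gal (σ : absoluteGaloisGroup F) : AinfRamW D →+* AinfRamW D :=
  AdjoinRoot.lift ((algebraMap (Ainf (p := p) F) (AinfRamW D)).comp (galAinf σ)) (varpi D) (by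
    rw [EisensteinRootW.eval₂_polyAinf, RingHom.comp_assoc, galAinf_comp_wittFixedToAinf hp]
    exact eval₂_varpi' D)

/-- `σ` on `𝔸_inf(F) ⊆ A_inf(𝒪_F)`. [cite: FontaineAsterisque223III, Exp. II §1.2] -/
@[simp] theorem gal_algebraMap (σ : absoluteGaloisGroup F) (a : Ainf (p := p) F) :
    gal D σ (algebraMap (Ainf (p := p) F) (AinfRamW D) a) = algebraMap (Ainf (p := p) F) (AinfRamW D) (galAinf σ a) :=
  AdjoinRoot.lift_of _

/-- **`σ(ϖ) = ϖ`.** [cite: FarguesFontaine2018, §1.2] -/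
@[simp] theorem gal_varpi (σ : absoluteGaloisGroup F) : gal D σ (varpi D) = varpi D := AdjoinRoot.lift_root _

/-- `1 ∈ Γ_F` acts trivially. [cite: FontaineAsterisque223III, Exp. II §1.2] -/
theorem gal_one (x : AinfRamW D) : gal D 1 x = x := by
  have h : gal D 1 = RingHom.id _ :=
    ringHom_ext D (fun a => by rw [gal_algebraMap, galAinf_one]; rfl) (by rw [gal_varpi]; rfl)
  rw [h]; rfl

/-- `(στ)` acts as `σ ∘ τ`. [cite: FontaineAsterisque223III, Exp. II §1.2] -/
theorem gal_mul (σ τ : absoluteGaloisGroup F) (x : AinfRamW D) : gal D (σ * τ) x = gal D σ (gal D τ x) := by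
  have h : gal D (σ * τ) = (gal D σ).comp (gal D τ) :=
    ringHom_ext D (fun a => by rw [RingHom.comp_apply, gal_algebraMap, gal_algebraMap, gal_algebraMap, galAinf_mul])
      (by rw [RingHom.comp_apply, gal_varpi, gal_varpi, gal_varpi])
  rw [h]; rfl

/-- `σ⁻¹ ∘ σ = id`. [cite: FontaineAsterisque223III, Exp. II §1.2] -/
theorem gal_inv_gal (σ : absoluteGaloisGroup F) (x : AinfRamW D) : gal D σ⁻¹ (gal D σ x) = x := by
  rw [← gal_mul, inv_mul_cancel, gal_one]

/-- `σ ∘ σ⁻¹ = id`. [cite: FontaineAsterisque223III, Exp. II §1.2] -/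
theorem gal_gal_inv (σ : absoluteGaloisGroup F) (x : AinfRamW D) : gal D σ (gal D σ⁻¹ x) = x := by
  rw [← gal_mul, mul_inv_cancel, gal_one]

/-- Each `σ` acts bijectively. [cite: FontaineAsterisque223III, Exp. II §1.2] -/
theorem gal_bijective (σ : absoluteGaloisGroup F) : Function.Bijective (gal D σ) :=
  ⟨fun x y h => by rw [← gal_inv_gal D σ x, ← gal_inv_gal D σ y, h], fun y => ⟨gal D σ⁻¹ y, gal_gal_inv D σ y⟩⟩

/-- `Γ_F` fixes the coefficient ring `𝒪_D ⊆ A_inf(𝒪_F)`. [cite: FarguesFontaine2018, §1.2] -/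
theorem gal_coeffHom (σ : absoluteGaloisGroup F) (x : D.Coeff) : gal D σ (coeffHom D x) = coeffHom D x := by
  have h : (gal D σ).comp (coeffHom D) = coeffHom D := by
    refine Ideal.Quotient.ringHom_ext (Polynomial.ringHom_ext' (RingHom.ext fun z => ?_) ?_)
    · change gal D σ (coeffHom D (AdjoinRoot.of D.poly z)) = coeffHom D (AdjoinRoot.of D.poly z)
      rw [coeffHom_of, gal_algebraMap, galAinf_wittFixedToAinf hp]
    · change gal D σ (coeffHom D (AdjoinRoot.root D.poly)) = coeffHom D (AdjoinRoot.root D.poly)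
      rw [coeffHom_root, gal_varpi]
  exact RingHom.congr_fun h x

/-! ## §4 `θ_𝒪 : A_inf(𝒪_F) → 𝒪_{ℂ_F}` -/

variable [IsAdicComplete (Ideal.span {(p : integerC F)}) (integerC F)]

/-- **`θ_𝒪 : A_inf(𝒪_F) → 𝒪_{ℂ_F}`**: Fontaine's `θ` on `𝔸_inf(F)` and `ϖ ↦ π` (well defined since `E(π) = 0` in
`𝒪_{ℂ_F}` along `θ ∘ (W(k_F) → 𝔸_inf) = (W(k_F) → 𝒪_{ℂ_F})`, tree `fontaineTheta_comp_wittFixedToAinf`).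
[cite: FarguesFontaine2018, §2.2] [cite: FontaineAsterisque223III, Exp. II §1.2.2] -/
def theta : AinfRamW D →+* integerC F :=
  AdjoinRoot.lift (fontaineTheta (integerC F) p) D.unifC (by
    rw [EisensteinRootW.eval₂_polyAinf, fontaineTheta_comp_wittFixedToAinf hp]
    exact D.eval₂_wittFixedToIntC_unifC)

/-- `θ_𝒪` extends `θ`. [cite: FontaineAsterisque223III, Exp. II §1.2.2] -/
@[simp] theorem theta_algebraMap (a : Ainf (p := p) F) :
    theta D (algebraMap (Ainf (p := p) F) (AinfRamW D) a) = fontaineTheta (integerC F) p a := AdjoinRoot.lift_of _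

/-- **`θ_𝒪(ϖ) = π`.** [cite: FarguesFontaine2018, §2.2] -/
@[simp] theorem theta_varpi : theta D (varpi D) = D.unifC := AdjoinRoot.lift_root _

/-- `θ_𝒪(ϖ) = π` in `ℂ_F`. [cite: FarguesFontaine2018, §2.2] -/
theorem coe_theta_varpi :
    ((theta D (varpi D) : integerC F) : CompletedAlgClosure F) = algebraMap F (CompletedAlgClosure F) D.unif := by
  rw [theta_varpi, EisensteinRootW.coe_unifC]

/-- `θ_𝒪` is surjective (already `θ` is, tree `surjective_fontaineTheta_integerC`). [cite: FontaineAsterisque223III, Exp. II §1.2.2] -/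
theorem theta_surjective (hθ : Function.Surjective (fontaineTheta (integerC F) p)) : Function.Surjective (theta D) :=
  fun y => by obtain ⟨a, ha⟩ := hθ y; exact ⟨algebraMap _ _ a, by rw [theta_algebraMap, ha]⟩

/-- `θ_𝒪` on the coefficients `W(k_F)`. [cite: FarguesFontaine2018, §2.2] -/
theorem theta_coeffHom_of (z : wittFixed F p) : theta D (coeffHom D (AdjoinRoot.of D.poly z)) = wittFixedToIntC F p hp z := by
  rw [coeffHom_of, theta_algebraMap, fontaineTheta_wittFixedToAinf hp]

/-- **`θ_𝒪 ∘ (𝒪_D → A_inf(𝒪_F)) = (𝒪_D → F ⊆ ℂ_F)`**: the coefficient ring is embedded compatibly. [cite: FarguesFontaine2018, §2.2] -/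
theorem coe_theta_coeffHom (x : D.Coeff) :
    ((theta D (coeffHom D x) : integerC F) : CompletedAlgClosure F) =
      algebraMap F (CompletedAlgClosure F) (EisensteinRootW.Coeff.toF D x) := by
  have h : ((integerC F).subtype.comp ((theta D).comp (coeffHom D))) =
      (algebraMap F (CompletedAlgClosure F)).comp (EisensteinRootW.Coeff.toF D) := by
    refine Ideal.Quotient.ringHom_ext (Polynomial.ringHom_ext' (RingHom.ext fun z => ?_) ?_)
    · change ((theta D (coeffHom D (AdjoinRoot.of D.poly z)) : integerC F) : CompletedAlgClosure F) =
        algebraMap F (CompletedAlgClosure F) (EisensteinRootW.Coeff.toF D (AdjoinRoot.of D.poly z))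
      rw [theta_coeffHom_of, EisensteinRootW.Coeff.toF_of, coe_wittFixedToIntC]
    · change ((theta D (coeffHom D (AdjoinRoot.root D.poly)) : integerC F) : CompletedAlgClosure F) =
        algebraMap F (CompletedAlgClosure F) (EisensteinRootW.Coeff.toF D (AdjoinRoot.root D.poly))
      rw [coeffHom_root, theta_varpi, EisensteinRootW.Coeff.toF_root, EisensteinRootW.coe_unifC]
  exact RingHom.congr_fun h x

/-- `θ_𝒪 ∘ (𝒪_D → A_inf(𝒪_F)) = (𝒪_D → 𝒪_F)` in `F`. [cite: FarguesFontaine2018, §2.2] -/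
theorem coe_theta_coeffHom' (x : D.Coeff) :
    ((theta D (coeffHom D x) : integerC F) : CompletedAlgClosure F) =
      algebraMap F (CompletedAlgClosure F) ((EisensteinRootW.Coeff.toInt D x : 𝒪[F]) : F) := by
  rw [coe_theta_coeffHom, EisensteinRootW.Coeff.coe_toInt]

/-- **`θ_𝒪` is `Γ_F`-equivariant**: `θ_𝒪(σ x) = σ(θ_𝒪 x)` in `ℂ_F` (tree `fontaineTheta_galAinf` and `σ π = π`).
[cite: FontaineAsterisque223III, Exp. II §1.2] -/
theorem coe_theta_gal (σ : absoluteGaloisGroup F) (x : AinfRamW D) :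
    ((theta D (gal D σ x) : integerC F) : CompletedAlgClosure F) = σ • ((theta D x : integerC F) : CompletedAlgClosure F) := by
  have h : (integerC F).subtype.comp ((theta D).comp (gal D σ)) =
      (CompletedAlgClosure.galRingHom σ).comp ((integerC F).subtype.comp (theta D)) := by
    refine ringHom_ext D (fun a => ?_) ?_
    · change ((theta D (gal D σ (algebraMap _ _ a)) : integerC F) : CompletedAlgClosure F) =
        CompletedAlgClosure.galRingHom σ ((theta D (algebraMap _ _ a) : integerC F) : CompletedAlgClosure F)
      rw [gal_algebraMap, theta_algebraMap, theta_algebraMap, fontaineTheta_galAinf, coe_galInt]; rfl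
    · change ((theta D (gal D σ (varpi D)) : integerC F) : CompletedAlgClosure F) =
        CompletedAlgClosure.galRingHom σ ((theta D (varpi D) : integerC F) : CompletedAlgClosure F)
      rw [gal_varpi, theta_varpi]
      exact (D.smul_coe_unifC σ).symm
  exact RingHom.congr_fun h x

/-- `θ_𝒪(σ x) = σ(θ_𝒪 x)` in `𝒪_{ℂ_F}` (tree `galInt`). [cite: FontaineAsterisque223III, Exp. II §1.2] -/
theorem theta_gal (σ : absoluteGaloisGroup F) (x : AinfRamW D) : theta D (gal D σ x) = galInt σ (theta D x) :=
  Subtype.ext (by rw [coe_theta_gal, coe_galInt])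

/-- `Γ_F` preserves `ker θ_𝒪`. [cite: FontaineAsterisque223III, Exp. II §1.2] -/
theorem theta_gal_eq_zero (σ : absoluteGaloisGroup F) {x : AinfRamW D} (hx : theta D x = 0) : theta D (gal D σ x) = 0 := by
  apply Subtype.ext
  rw [coe_theta_gal, hx, ZeroMemClass.coe_zero, smul_zero]

end AinfRamW

end Ring

end Literature.NumberTheory.PAdicHodge

end
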